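import Literature.Computability.AlgebraicComplexity.FlipGraph222OrbitCanon
import Literature.Computability.AlgebraicComplexity.FlipGraph222StdComponent
import HarnessLib

/-!
# The component of the standard algorithm has exactly `273` vertices — key replay 2/3 (`(2,2,2)`, `ℤ₂`; KM 2023 §4)

Topic `Literature/Computability/AlgebraicComplexity`. Source: M. Kauers, J. Moosbauer, *Flip Graphs
for Matrix Multiplication*, ISSAC 2023 = arXiv:2212.01175 (KM), §4 / Fig. 1: the connected component
of the standard algorithm in the `(2,2,2)`-flip graph of rank at most `8` over `ℤ₂` "has `272`
vertices, each representing the orbit of one multiplication scheme".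

## What is typed (everything PROVED, kernel replay; no definitions, no named facts)

`FlipGraph222StdComponent.lean` lists `273` code lists `Comp222.creps` whose orbits ARE the component
of the standard algorithm (`Comp222.kauersMoosbauer2023_fig1_component_eq`), and
`FlipGraph222OrbitCanon.lean` provides a `G`-invariant key `Canon222.canonKey` of well-formed code
lists together with the table `Canon222.canonTab` of the `273` keys reduced modulo the prime
`Canon222.keyMod = 2⁶¹ − 1`, pairwise distinct (`Canon222.canonTab_nodup`). This file replays, in the kernel,
`canonKey creps[i] % keyMod = canonTab[i]` for the representatives `96 ≤ i < 192` (chunks of `6`,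
`decide +kernel`); the sibling files cover the other indices, and
`FlipGraph222StdComponentCanon3.lean` concludes: the `273` listed orbits are pairwise distinct
(`Comp222.cv_injective`), so the component has EXACTLY `273` vertices
(`Comp222.kauersMoosbauer2023_fig1_component_card`; KM print `272`).

## References

* M. Kauers, J. Moosbauer, *Flip Graphs for Matrix Multiplication*, ISSAC 2023, 381–388,
  doi:10.1145/3597066.3597120, arXiv:2212.01175: §2 (equivalence = same orbit), Def. 8, Thm. 9,
  §4 and Fig. 1 ("It has 272 vertices"). [KauersMoosbauer2022FlipGraphs]
-/

set_option Elab.async false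

namespace Literature.Computability.AlgebraicComplexity

namespace FlipGraph

namespace Comp222

open Cert222 StdBall222 Hidden222 Canon222

/-- Key replay, chunk 16 (representatives `96 ≤ i < 102`): the canonical key of `creps[i]`,
reduced modulo `keyMod`, is `canonTab[i]` (kernel evaluation). [cite: KauersMoosbauer2022FlipGraphs, §4 ("It has 272 vertices"), §2 (equivalence = same orbit)] -/
theorem canonOk_16 : ((List.range' 96 6).all fun i =>
    canonKey (creps.getD i []) % keyMod == canonTab.getD i 0) = true := by
  decide +kernel

/-- Key replay, chunk 17 (representatives `102 ≤ i < 108`): the canonical key of `creps[i]`,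
reduced modulo `keyMod`, is `canonTab[i]` (kernel evaluation). [cite: KauersMoosbauer2022FlipGraphs, §4 ("It has 272 vertices"), §2 (equivalence = same orbit)] -/
theorem canonOk_17 : ((List.range' 102 6).all fun i =>
    canonKey (creps.getD i []) % keyMod == canonTab.getD i 0) = true := by
  decide +kernel

/-- Key replay, chunk 18 (representatives `108 ≤ i < 114`): the canonical key of `creps[i]`,
reduced modulo `keyMod`, is `canonTab[i]` (kernel evaluation). [cite: KauersMoosbauer2022FlipGraphs, §4 ("It has 272 vertices"), §2 (equivalence = same orbit)] -/
theorem canonOk_18 : ((List.range' 108 6).all fun i =>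
    canonKey (creps.getD i []) % keyMod == canonTab.getD i 0) = true := by
  decide +kernel

/-- Key replay, chunk 19 (representatives `114 ≤ i < 120`): the canonical key of `creps[i]`,
reduced modulo `keyMod`, is `canonTab[i]` (kernel evaluation). [cite: KauersMoosbauer2022FlipGraphs, §4 ("It has 272 vertices"), §2 (equivalence = same orbit)] -/
theorem canonOk_19 : ((List.range' 114 6).all fun i =>
    canonKey (creps.getD i []) % keyMod == canonTab.getD i 0) = true := by
  decide +kernel

/-- Key replay, chunk 20 (representatives `120 ≤ i < 126`): the canonical key of `creps[i]`,
reduced modulo `keyMod`, is `canonTab[i]` (kernel evaluation). [cite: KauersMoosbauer2022FlipGraphs, §4 ("It has 272 vertices"), §2 (equivalence = same orbit)] -/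
theorem canonOk_20 : ((List.range' 120 6).all fun i =>
    canonKey (creps.getD i []) % keyMod == canonTab.getD i 0) = true := by
  decide +kernel

/-- Key replay, chunk 21 (representatives `126 ≤ i < 132`): the canonical key of `creps[i]`,
reduced modulo `keyMod`, is `canonTab[i]` (kernel evaluation). [cite: KauersMoosbauer2022FlipGraphs, §4 ("It has 272 vertices"), §2 (equivalence = same orbit)] -/
theorem canonOk_21 : ((List.range' 126 6).all fun i =>
    canonKey (creps.getD i []) % keyMod == canonTab.getD i 0) = true := by
  decide +kernel

/-- Key replay, chunk 22 (representatives `132 ≤ i < 138`): the canonical key of `creps[i]`,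
reduced modulo `keyMod`, is `canonTab[i]` (kernel evaluation). [cite: KauersMoosbauer2022FlipGraphs, §4 ("It has 272 vertices"), §2 (equivalence = same orbit)] -/
theorem canonOk_22 : ((List.range' 132 6).all fun i =>
    canonKey (creps.getD i []) % keyMod == canonTab.getD i 0) = true := by
  decide +kernel

/-- Key replay, chunk 23 (representatives `138 ≤ i < 144`): the canonical key of `creps[i]`,
reduced modulo `keyMod`, is `canonTab[i]` (kernel evaluation). [cite: KauersMoosbauer2022FlipGraphs, §4 ("It has 272 vertices"), §2 (equivalence = same orbit)] -/
theorem canonOk_23 : ((List.range' 138 6).all fun i =>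
    canonKey (creps.getD i []) % keyMod == canonTab.getD i 0) = true := by
  decide +kernel

/-- Key replay, chunk 24 (representatives `144 ≤ i < 150`): the canonical key of `creps[i]`,
reduced modulo `keyMod`, is `canonTab[i]` (kernel evaluation). [cite: KauersMoosbauer2022FlipGraphs, §4 ("It has 272 vertices"), §2 (equivalence = same orbit)] -/
theorem canonOk_24 : ((List.range' 144 6).all fun i =>
    canonKey (creps.getD i []) % keyMod == canonTab.getD i 0) = true := by
  decide +kernel

/-- Key replay, chunk 25 (representatives `150 ≤ i < 156`): the canonical key of `creps[i]`,
reduced modulo `keyMod`, is `canonTab[i]` (kernel evaluation). [cite: KauersMoosbauer2022FlipGraphs, §4 ("It has 272 vertices"), §2 (equivalence = same orbit)] -/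
theorem canonOk_25 : ((List.range' 150 6).all fun i =>
    canonKey (creps.getD i []) % keyMod == canonTab.getD i 0) = true := by
  decide +kernel

/-- Key replay, chunk 26 (representatives `156 ≤ i < 162`): the canonical key of `creps[i]`,
reduced modulo `keyMod`, is `canonTab[i]` (kernel evaluation). [cite: KauersMoosbauer2022FlipGraphs, §4 ("It has 272 vertices"), §2 (equivalence = same orbit)] -/
theorem canonOk_26 : ((List.range' 156 6).all fun i =>
    canonKey (creps.getD i []) % keyMod == canonTab.getD i 0) = true := by
  decide +kernel

/-- Key replay, chunk 27 (representatives `162 ≤ i < 168`): the canonical key of `creps[i]`,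
reduced modulo `keyMod`, is `canonTab[i]` (kernel evaluation). [cite: KauersMoosbauer2022FlipGraphs, §4 ("It has 272 vertices"), §2 (equivalence = same orbit)] -/
theorem canonOk_27 : ((List.range' 162 6).all fun i =>
    canonKey (creps.getD i []) % keyMod == canonTab.getD i 0) = true := by
  decide +kernel

/-- Key replay, chunk 28 (representatives `168 ≤ i < 174`): the canonical key of `creps[i]`,
reduced modulo `keyMod`, is `canonTab[i]` (kernel evaluation). [cite: KauersMoosbauer2022FlipGraphs, §4 ("It has 272 vertices"), §2 (equivalence = same orbit)] -/
theorem canonOk_28 : ((List.range' 168 6).all fun i =>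
    canonKey (creps.getD i []) % keyMod == canonTab.getD i 0) = true := by
  decide +kernel

/-- Key replay, chunk 29 (representatives `174 ≤ i < 180`): the canonical key of `creps[i]`,
reduced modulo `keyMod`, is `canonTab[i]` (kernel evaluation). [cite: KauersMoosbauer2022FlipGraphs, §4 ("It has 272 vertices"), §2 (equivalence = same orbit)] -/
theorem canonOk_29 : ((List.range' 174 6).all fun i =>
    canonKey (creps.getD i []) % keyMod == canonTab.getD i 0) = true := by
  decide +kernel

/-- Key replay, chunk 30 (representatives `180 ≤ i < 186`): the canonical key of `creps[i]`,
reduced modulo `keyMod`, is `canonTab[i]` (kernel evaluation). [cite: KauersMoosbauer2022FlipGraphs, §4 ("It has 272 vertices"), §2 (equivalence = same orbit)] -/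
theorem canonOk_30 : ((List.range' 180 6).all fun i =>
    canonKey (creps.getD i []) % keyMod == canonTab.getD i 0) = true := by
  decide +kernel

/-- Key replay, chunk 31 (representatives `186 ≤ i < 192`): the canonical key of `creps[i]`,
reduced modulo `keyMod`, is `canonTab[i]` (kernel evaluation). [cite: KauersMoosbauer2022FlipGraphs, §4 ("It has 272 vertices"), §2 (equivalence = same orbit)] -/
theorem canonOk_31 : ((List.range' 186 6).all fun i =>
    canonKey (creps.getD i []) % keyMod == canonTab.getD i 0) = true := by
  decide +kernel

end Comp222

end FlipGraph

end Literature.Computability.AlgebraicComplexity
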